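import Mathlib
import Summits.ResolutionOfSingularities.ResolutionOfSingularities.Theorems.WildQuotientsWildQuotientResolutionJordanFourChartCAug

/-!
# V4U: the augmentation ideal over the smooth chart `D₊(x_c⁶ t)` of `Bl_{I₆} 𝔸ⁿ`, in ANY Rees chart

(crux stmt-ResolutionOfSingularities-15640 `WildQuotients.WildQuotientResolution`, line `Sketch`,
sector `|G| = p`; programme V4U of `L/w45c/CHAIN.md` v5; chart-change companion of stub-2's
`JordanFour.chartC_span_eq` (p490497) for lead-1's stalk mechanism (`ToricExit.I2.chart_isPrincipal`
pattern, p486940). [OURS · L1 W4.5c] — NOT a statement of any manuscript; replaces the role of no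
printed item. Prover res-L1-w45c-stub-4.)

`I6.chart_isPrincipal`: in a domain `S` with a ring endomorphism `a` of `J₄`-type
(`a x_a = x_a`, `a x_b = x_b + m x_a`, `a x_c = x_c + m x_b + m' x_a`), let `T = K_j ≠ 0` be the
`j`-th generator of `I₆ = (x_a², x_a x_b², x_a x_b x_c, x_a x_c³, x_b³, x_b² x_c², x_b x_c⁴, x_c⁶)` and
`T · U_l = K_l` the Rees-chart relations; if every `K_l` is a multiple of `x_c⁶` (the point lies over
the smooth chart), then `(x_a, x_b, x_c) + (a U_l − U_l : l ≠ j) = (x_c)` — in particular principal.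
(`U_7 = x_c⁶/T` is a unit, `U_l = U_7 · e_l` with `x_c⁶ e_l = K_l`, and stub-2's `chartC_span_eq`.)
-/

-- single-problem summit: the doubled namespace component `ResolutionOfSingularities` is forced
set_option linter.dupNamespace false

noncomputable section

namespace Summit.ResolutionOfSingularities.ResolutionOfSingularities.Theorems.WildQuotientResolution.JordanFour

/-- **The augmentation ideal over the smooth chart, read in any Rees chart `j`**: with the notation
of the module docstring, `(x_a, x_b, x_c) + (a U_l − U_l : l ≠ j) = (x_c)`. [folklore] -/
theorem I6.chart_span_eq {S : Type} [CommRing S] [IsDomain S] (xa xb xc T m m' : S)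
    (U : Fin 8 → S) (a : S →+* S) (ha : a xa = xa) (hb : a xb = xb + m * xa)
    (hc : a xc = xc + m * xb + m' * xa) (hT : T ≠ 0) (j : Fin 8)
    (hTj : T = (![xa ^ 2, xa * xb ^ 2, xa * xb * xc, xa * xc ^ 3, xb ^ 3, xb ^ 2 * xc ^ 2,
      xb * xc ^ 4, xc ^ 6] : Fin 8 → S) j)
    (hU : ∀ l, T * U l = (![xa ^ 2, xa * xb ^ 2, xa * xb * xc, xa * xc ^ 3, xb ^ 3,
      xb ^ 2 * xc ^ 2, xb * xc ^ 4, xc ^ 6] : Fin 8 → S) l)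
    (hmem : ∀ l, (![xa ^ 2, xa * xb ^ 2, xa * xb * xc, xa * xc ^ 3, xb ^ 3, xb ^ 2 * xc ^ 2,
      xb * xc ^ 4, xc ^ 6] : Fin 8 → S) l ∈ Ideal.span ({xc ^ 6} : Set S)) :
    Ideal.span ({xa, xb, xc} : Set S) ⊔
      Ideal.span (Set.range fun l : {l : Fin 8 // l ≠ j} => a (U l) - U l) =
      Ideal.span ({xc} : Set S) := by
  classical
  -- `e l` with `x_c⁶ e l = K l`
  choose e' he' using fun l => Ideal.mem_span_singleton'.mp (hmem l)
  let e : {l : Fin 8 // l ≠ (7 : Fin 8)} → S := fun l => e' l.1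
  have he : ∀ l : {l : Fin 8 // l ≠ (7 : Fin 8)}, xc ^ 6 * e l =
      (![xa ^ 2, xa * xb ^ 2, xa * xb * xc, xa * xc ^ 3, xb ^ 3, xb ^ 2 * xc ^ 2, xb * xc ^ 4,
        xc ^ 6] : Fin 8 → S) l.1 := fun l => by rw [mul_comm]; exact he' l.1
  have hA := chartC_span_eq xa xb xc m m' ?hxc a ha hb hc e he
  case hxc =>
    intro h0
    apply hT
    have h := he' j
    rw [← hTj, h0, zero_pow (by norm_num), mul_zero] at h
    exact h.symm
  have hxc : xc ≠ 0 := by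
    intro h0
    apply hT
    have h := he' j
    rw [← hTj, h0, zero_pow (by norm_num), mul_zero] at h
    exact h.symm
  have hxc6 : xc ^ 6 ≠ 0 := pow_ne_zero 6 hxc
  -- `w := e' j`, `T = w · x_c⁶`, `U 7 = w⁻¹`
  have hTw : T = e' j * xc ^ 6 := by rw [hTj]; exact (he' j).symm
  have hwU7 : e' j * U 7 = 1 := by
    have h := hU 7
    have h7 : (![xa ^ 2, xa * xb ^ 2, xa * xb * xc, xa * xc ^ 3, xb ^ 3, xb ^ 2 * xc ^ 2, xb * xc ^ 4,
        xc ^ 6] : Fin 8 → S) 7 = xc ^ 6 := rfl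
    rw [h7, hTw] at h
    exact mul_right_cancel₀ hxc6 (by rw [one_mul]; linear_combination h)
  have haw : a (e' j) * a (U 7) = 1 := by rw [← map_mul, hwU7, map_one]
  -- `U l = U 7 · e' l`
  have hUl : ∀ l, U l = U 7 * e' l := by
    intro l
    have h := hU l
    rw [← he' l, hTw] at h
    -- `e' j * xc^6 * U l = e' l * xc^6`
    have h2 : xc ^ 6 * (e' j * U l) = xc ^ 6 * e' l := by linear_combination h
    have h3 := mul_left_cancel₀ hxc6 h2
    calc U l = (e' j * U 7) * U l := by rw [hwU7, one_mul]
      _ = U 7 * (e' j * U l) := by ring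
      _ = U 7 * e' l := by rw [h3]
  -- the two augmentation ideals coincide
  have hgen7 : a (U 7) - U 7 ∈ Ideal.span ({xa, xb, xc} : Set S) ⊔
      Ideal.span (Set.range fun l : {l : Fin 8 // l ≠ (7 : Fin 8)} => a (e l) - e l) := by
    by_cases hj : j = 7
    · -- then `e' j * 1`-type: `T = xc^6`, `e' j = 1`? only `e' j * xc^6 = xc^6`:
      have hw1 : e' j = 1 := by
        have h := he' j
        have h7 : (![xa ^ 2, xa * xb ^ 2, xa * xb * xc, xa * xc ^ 3, xb ^ 3, xb ^ 2 * xc ^ 2,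
            xb * xc ^ 4, xc ^ 6] : Fin 8 → S) j = xc ^ 6 := by rw [hj]; rfl
        rw [h7] at h
        exact mul_right_cancel₀ hxc6 (by rw [one_mul]; exact h)
      have hU7 : U 7 = 1 := by
        have h := hwU7; rw [hw1, one_mul] at h; exact h
      rw [hU7, map_one, sub_self]
      exact Ideal.zero_mem _
    · have e1 : a (U 7) - U 7 = -(a (U 7) * U 7) * (a (e ⟨j, hj⟩) - e ⟨j, hj⟩) := by
        change a (U 7) - U 7 = -(a (U 7) * U 7) * (a (e' j) - e' j)
        linear_combination (U 7) * haw - (a (U 7)) * hwU7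
      rw [e1]
      exact Ideal.mul_mem_left _ _ (Ideal.mem_sup_right (Ideal.subset_span ⟨⟨j, hj⟩, rfl⟩))
  rw [← hA]
  apply le_antisymm
  · refine sup_le le_sup_left ?_
    rw [Ideal.span_le]
    rintro _ ⟨⟨l, hl⟩, rfl⟩
    change a (U l) - U l ∈ _
    by_cases hl7 : l = 7
    · subst hl7; exact hgen7
    · have e1 : a (U l) - U l = a (U 7) * (a (e ⟨l, hl7⟩) - e ⟨l, hl7⟩) + (a (U 7) - U 7) * e ⟨l, hl7⟩ := by
        change a (U l) - U l = a (U 7) * (a (e' l) - e' l) + (a (U 7) - U 7) * e' l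
        rw [hUl l, map_mul]; ring
      rw [e1]
      exact Ideal.add_mem _ (Ideal.mul_mem_left _ _ (Ideal.mem_sup_right
        (Ideal.subset_span ⟨⟨l, hl7⟩, rfl⟩))) (Ideal.mul_mem_right _ _ hgen7)
  · refine sup_le le_sup_left ?_
    rw [Ideal.span_le]
    rintro _ ⟨⟨l, hl7⟩, rfl⟩
    change a (e' l) - e' l ∈ _
    -- `e' l = e' j * U l`
    have hel : e' l = e' j * U l := by
      rw [hUl l, ← mul_assoc, hwU7, one_mul]
    by_cases hj7 : j = 7
    · have hw1 : e' j = 1 := by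
        have h := he' j
        have h7 : (![xa ^ 2, xa * xb ^ 2, xa * xb * xc, xa * xc ^ 3, xb ^ 3, xb ^ 2 * xc ^ 2,
            xb * xc ^ 4, xc ^ 6] : Fin 8 → S) j = xc ^ 6 := by rw [hj7]; rfl
        rw [h7] at h
        exact mul_right_cancel₀ hxc6 (by rw [one_mul]; exact h)
      rw [hw1, one_mul] at hel
      have hlj : l ≠ j := by rw [hj7]; exact hl7
      rw [hel]
      exact Ideal.mem_sup_right (Ideal.subset_span ⟨⟨l, hlj⟩, rfl⟩)
    · -- `a w - w ∈ LHS_j` via the generator `l = 7 ≠ j`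
      have h7j : (7 : Fin 8) ≠ j := fun h => hj7 h.symm
      have haw' : a (e' j) - e' j ∈ Ideal.span ({xa, xb, xc} : Set S) ⊔
          Ideal.span (Set.range fun l : {l : Fin 8 // l ≠ j} => a (U l) - U l) := by
        have e1 : a (e' j) - e' j = -(a (e' j) * e' j) * (a (U 7) - U 7) := by
          linear_combination (e' j) * haw - (a (e' j)) * hwU7
        rw [e1]
        exact Ideal.mul_mem_left _ _ (Ideal.mem_sup_right (Ideal.subset_span ⟨⟨7, h7j⟩, rfl⟩))
      by_cases hlj : l = j
      · subst hlj; exact haw'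
      · have e1 : a (e' l) - e' l = a (e' j) * (a (U l) - U l) + (a (e' j) - e' j) * U l := by
          rw [hel, map_mul]; ring
        rw [e1]
        exact Ideal.add_mem _ (Ideal.mul_mem_left _ _ (Ideal.mem_sup_right
          (Ideal.subset_span ⟨⟨l, hlj⟩, rfl⟩))) (Ideal.mul_mem_right _ _ haw')

/-- **Corollary: the ideal is principal.** [folklore] -/
theorem I6.chart_isPrincipal {S : Type} [CommRing S] [IsDomain S] (xa xb xc T m m' : S)
    (U : Fin 8 → S) (a : S →+* S) (ha : a xa = xa) (hb : a xb = xb + m * xa)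
    (hc : a xc = xc + m * xb + m' * xa) (hT : T ≠ 0) (j : Fin 8)
    (hTj : T = (![xa ^ 2, xa * xb ^ 2, xa * xb * xc, xa * xc ^ 3, xb ^ 3, xb ^ 2 * xc ^ 2,
      xb * xc ^ 4, xc ^ 6] : Fin 8 → S) j)
    (hU : ∀ l, T * U l = (![xa ^ 2, xa * xb ^ 2, xa * xb * xc, xa * xc ^ 3, xb ^ 3,
      xb ^ 2 * xc ^ 2, xb * xc ^ 4, xc ^ 6] : Fin 8 → S) l)
    (hmem : ∀ l, (![xa ^ 2, xa * xb ^ 2, xa * xb * xc, xa * xc ^ 3, xb ^ 3, xb ^ 2 * xc ^ 2,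
      xb * xc ^ 4, xc ^ 6] : Fin 8 → S) l ∈ Ideal.span ({xc ^ 6} : Set S)) :
    (Ideal.span ({xa, xb, xc} : Set S) ⊔
      Ideal.span (Set.range fun l : {l : Fin 8 // l ≠ j} => a (U l) - U l)).IsPrincipal := by
  rw [I6.chart_span_eq xa xb xc T m m' U a ha hb hc hT j hTj hU hmem]
  exact ⟨⟨xc, rfl⟩⟩

end Summit.ResolutionOfSingularities.ResolutionOfSingularities.Theorems.WildQuotientResolution.JordanFour

end
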